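import Mathlib
import Literature.AlgebraicGeometry.Resolution.Ridge
import Literature.RingTheory.HilbertSamuel.HilbertFunctionBaseChange
import HarnessLib

/-!
# [OURS · L1 W4.2] Jets and the Hilbert–Samuel numbers of a cone at a rational point — toolkit for the
# ridge cone theorem (campaign s42 of cell res-hironaka, LADDER-RESOLUTION rung L; informal crux
# `RidgeConfinement`, stmt-ResolutionOfSingularities-17845; `--supports`)

HONEST FRAMING. OURS (slot W4.2, prover res-L1-s42-pv-1, gen 2): elementary commutative algebra in
`S = K[X_1, …, X_n]` over a field `K`, used by `…CampaignW42RidgeConeNear.lean` (the cone theorem: a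
rational point of a cone at which the Hilbert–Samuel function does not drop lies in Giraud's ridge).
NOTHING here is a statement of H. Hironaka's manuscript [Hironaka2017]. AI review is weaker than expert
review.

## Content (`𝔪 = (X_1, …, X_n) = MvPolynomial.idealOfVars`, `τ_v = Literature.RingTheory.MvPolynomial.shift v`)

* `jet K n d` — the truncation `jet_d f = Σ_{e ≤ d} f_e` below degree `d` (a `K`-linear map; DEFINITION);
  `coeff_jet`, `jet_eq_self_of_totalDegree_le`, `totalDegree_jet_le`, **`jet_eq_zero_iff` / `ker_jet`:
  `ker jet_d = 𝔪^{d+1}`**, `range_jet_le`, `finite_range_jet`; for a HOMOGENEOUS ideal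
  (`Literature.RingTheory.HilbertSamuel.IsHomogeneousIdeal`) `jet_mem_of_isHomogeneousIdeal`, and
  conversely `isHomogeneousIdeal_of_jet_mem` (an ideal closed under all jets is homogeneous);
* **`finrank_quotient_add_finrank_map_jet`**: `dim_K S/(J + 𝔪^{d+1}) + dim_K jet_d(J) = dim_K jet_d(S)`
  for EVERY ideal `J` — the Hilbert–Samuel number `H⁽¹⁾(d) = ℓ(S_𝔪/(J + 𝔪^{d+1})S_𝔪)` of `S/J` at the
  origin, computed through `S/(J + 𝔪^{d+1}) ≅ jet_d(S)/jet_d(J)`;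
* `inf_restrictTotalDegree_le_map_jet` (`J ∩ S_{≤d} ⊆ jet_d(J)`), `map_jet_eq_of_isHomogeneousIdeal`
  (`jet_d(I) = I ∩ S_{≤d}` for homogeneous `I`), `finrank_inf_le_finrank_map_shift_inf`
  (`dim I ∩ S_{≤d} ≤ dim τ_v I ∩ S_{≤d}`: `τ_v` is injective and preserves degrees);
* the point `v ∈ Kⁿ` versus the origin: `ker_eval_zero` (`ker(eval 0) = 𝔪`), `map_shift_ker_eval`
  (`τ_v 𝔪_v = 𝔪` for `𝔪_v = ker(eval v)`), `shiftEquiv` (`τ_v` as a `K`-algebra automorphism;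
  DEFINITION), **`finrank_quotient_sup_ker_eval_pow_eq`:
  `dim_K S/(I + 𝔪_v^{d+1}) = dim_K S/(τ_v I + 𝔪^{d+1})`** (the Hilbert–Samuel numbers at `v` are those
  of the translated cone `τ_v I` at the origin); `shift_neg_mem_of_mem_map_shift`, `coneIdeal_self`
  (`I · K[X] = I` for Giraud's `coneIdeal` at `k' = K`).

References (orientation only): V. Cossart, U. Jannsen, S. Saito, LNM 2270 (2020), §2.2 (Hilbert–Samuel
functions `H⁽¹⁾_𝒪(n) = ℓ(𝒪/𝔪ⁿ⁺¹)`); J. Giraud, Ann. Sci. ÉNS 8 (1975) §1.5.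
-/

noncomputable section

-- single-conjunct summit: the doubled namespace component `ResolutionOfSingularities` is mandated
set_option linter.dupNamespace false

open MvPolynomial Module
open Literature.RingTheory.MvPolynomial (shift shift_X shift_shift shift_zero shift_injective eval_shift
  totalDegree_shift_le)
open Literature.RingTheory.HilbertSamuel (IsHomogeneousIdeal)
open Literature.AlgebraicGeometry.Resolution

namespace Summit.ResolutionOfSingularities.ResolutionOfSingularities.Theorems

namespace CampaignW42

universe u

variable {K : Type u} [Field K] {n : ℕ}

/-! ## Jets: truncation below a degree -/

variable (K n) in
/-- The jet (truncation) `jet_d f = Σ_{e ≤ d} f_e` of a polynomial below degree `d`, as a `K`-linear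
map; `ker jet_d = 𝔪^{d+1}` (`jet_eq_zero_iff`), so `jet_d` models `S → S/𝔪^{d+1}`. [folklore] -/
def jet (d : ℕ) : MvPolynomial (Fin n) K →ₗ[K] MvPolynomial (Fin n) K :=
  ∑ e ∈ Finset.range (d + 1), homogeneousComponent e

/-- Unfolding `jet`. [folklore] -/
theorem jet_apply (d : ℕ) (f : MvPolynomial (Fin n) K) :
    jet K n d f = ∑ e ∈ Finset.range (d + 1), homogeneousComponent e f := by
  simp only [jet, LinearMap.coe_sum, Finset.sum_apply]

/-- The coefficients of the jet: those of `f` in degrees `≤ d`, zero above. [folklore] -/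
theorem coeff_jet (d : ℕ) (f : MvPolynomial (Fin n) K) (m : Fin n →₀ ℕ) :
    coeff m (jet K n d f) = if m.degree ≤ d then coeff m f else 0 := by
  rw [jet_apply, coeff_sum]
  simp_rw [coeff_homogeneousComponent]
  rw [Finset.sum_ite_eq]
  simp only [Finset.mem_range, Nat.lt_succ_iff]

/-- A polynomial of degree `≤ d` is its own `d`-jet. [folklore] -/
theorem jet_eq_self_of_totalDegree_le {d : ℕ} {f : MvPolynomial (Fin n) K} (h : f.totalDegree ≤ d) :
    jet K n d f = f := by
  classical
  ext m
  rw [coeff_jet]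
  split_ifs with hm
  · rfl
  · symm
    exact coeff_eq_zero_of_totalDegree_lt (lt_of_le_of_lt h (by rw [← Finsupp.degree_apply]; omega))

/-- Jets have degree `≤ d`. [folklore] -/
theorem totalDegree_jet_le (d : ℕ) (f : MvPolynomial (Fin n) K) : (jet K n d f).totalDegree ≤ d := by
  classical
  rw [totalDegree]
  refine Finset.sup_le fun s hs => ?_
  rw [MvPolynomial.mem_support_iff, coeff_jet] at hs
  split_ifs at hs with h
  · rw [Finsupp.degree_apply] at h
    exact h
  · exact absurd rfl hs

/-- **`ker jet_d = 𝔪^{d+1}`**: the `d`-jet vanishes iff all coefficients in degrees `≤ d` vanish iff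
`f ∈ (X_1, …, X_n)^{d+1}` (Mathlib `MvPolynomial.mem_pow_idealOfVars_iff'`). [folklore] -/
theorem jet_eq_zero_iff (d : ℕ) (f : MvPolynomial (Fin n) K) :
    jet K n d f = 0 ↔ f ∈ idealOfVars (Fin n) K ^ (d + 1) := by
  classical
  rw [mem_pow_idealOfVars_iff', MvPolynomial.ext_iff]
  refine forall_congr' fun m => ?_
  rw [coeff_jet, coeff_zero, Nat.lt_succ_iff]
  constructor
  · intro h hm
    rwa [if_pos hm] at h
  · intro h
    split_ifs with hm
    · exact h hm
    · rfl

/-- `ker jet_d = 𝔪^{d+1}` as `K`-subspaces. [folklore] -/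
theorem ker_jet (d : ℕ) :
    LinearMap.ker (jet K n d) = (idealOfVars (Fin n) K ^ (d + 1)).restrictScalars K := by
  ext f
  rw [LinearMap.mem_ker, Submodule.restrictScalars_mem, jet_eq_zero_iff]

/-- The image of `jet_d` consists of polynomials of degree `≤ d`. [folklore] -/
theorem range_jet_le (d : ℕ) : LinearMap.range (jet K n d) ≤ restrictTotalDegree (Fin n) K d := by
  rintro _ ⟨f, rfl⟩
  rw [mem_restrictTotalDegree]
  exact totalDegree_jet_le d f

/-- The image of `jet_d` is finite-dimensional. [folklore] -/
theorem finite_range_jet (d : ℕ) : Module.Finite K (LinearMap.range (jet K n d)) :=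
  Module.Finite.of_injective (Submodule.inclusion (range_jet_le d)) (Submodule.inclusion_injective _)

/-- Jets of elements of a HOMOGENEOUS ideal stay in the ideal. [folklore] -/
theorem jet_mem_of_isHomogeneousIdeal {I : Ideal (MvPolynomial (Fin n) K)} (hI : IsHomogeneousIdeal I)
    {f : MvPolynomial (Fin n) K} (hf : f ∈ I) (d : ℕ) : jet K n d f ∈ I := by
  rw [jet_apply]
  exact Ideal.sum_mem _ fun e _ => hI f hf e

/-- Homogeneous components are differences of consecutive jets. [folklore] -/
theorem homogeneousComponent_succ_eq_jet_sub (d : ℕ) (f : MvPolynomial (Fin n) K) :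
    homogeneousComponent (d + 1) f = jet K n (d + 1) f - jet K n d f := by
  rw [jet_apply, jet_apply, Finset.sum_range_succ, add_sub_cancel_left]

/-- The `0`-jet is the constant term. [folklore] -/
theorem jet_zero_eq (f : MvPolynomial (Fin n) K) : jet K n 0 f = homogeneousComponent 0 f := by
  rw [jet_apply, zero_add, Finset.sum_range_one]

/-- An ideal closed under all jets is homogeneous. [folklore] -/
theorem isHomogeneousIdeal_of_jet_mem {J : Ideal (MvPolynomial (Fin n) K)}
    (h : ∀ g ∈ J, ∀ d : ℕ, jet K n d g ∈ J) : IsHomogeneousIdeal J := by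
  intro g hg d
  cases d with
  | zero => rw [← jet_zero_eq]; exact h g hg 0
  | succ d => rw [homogeneousComponent_succ_eq_jet_sub]; exact J.sub_mem (h g hg _) (h g hg _)

/-! ## The Hilbert–Samuel numbers at the origin through jets -/

/-- Restricting scalars commutes with the supremum of two ideals. [folklore] -/
theorem restrictScalars_sup (J J' : Ideal (MvPolynomial (Fin n) K)) :
    (J ⊔ J').restrictScalars K = J.restrictScalars K ⊔ J'.restrictScalars K := by
  ext f
  simp only [Submodule.restrictScalars_mem, Submodule.mem_sup]

/-- **`dim_K S/(J + 𝔪^{d+1}) + dim_K jet_d(J) = dim_K jet_d(S)`** for every ideal `J`: the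
Hilbert–Samuel number `H⁽¹⁾(d)` of `S/J` at the origin, computed through jets (`jet_d` induces
`S/(J + 𝔪^{d+1}) ≅ jet_d(S)/jet_d(J)`). [folklore] -/
theorem finrank_quotient_add_finrank_map_jet (J : Ideal (MvPolynomial (Fin n) K)) (d : ℕ) :
    finrank K (MvPolynomial (Fin n) K ⧸ (J ⊔ idealOfVars (Fin n) K ^ (d + 1))) +
      finrank K (Submodule.map (jet K n d) (J.restrictScalars K)) =
        finrank K (LinearMap.range (jet K n d)) := by
  haveI := finite_range_jet (K := K) (n := n) d
  set W := LinearMap.range (jet K n d) with hW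
  set V := Submodule.map (jet K n d) (J.restrictScalars K) with hV
  have hVW : V ≤ W := LinearMap.map_le_range
  -- the composite `S → S → S/V`
  let φ : MvPolynomial (Fin n) K →ₗ[K] (MvPolynomial (Fin n) K ⧸ V) := V.mkQ ∘ₗ jet K n d
  have hker : LinearMap.ker φ = (J ⊔ idealOfVars (Fin n) K ^ (d + 1)).restrictScalars K := by
    rw [LinearMap.ker_comp, Submodule.ker_mkQ, Submodule.comap_map_eq, ker_jet, restrictScalars_sup]
  have hrange : LinearMap.range φ = W.map V.mkQ := by
    rw [LinearMap.range_comp]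
  -- rank–nullity for `W → S/V`
  have hrn := LinearMap.finrank_range_add_finrank_ker (V.mkQ ∘ₗ W.subtype)
  rw [LinearMap.range_comp, Submodule.range_subtype, LinearMap.ker_comp, Submodule.ker_mkQ,
    (Submodule.comapSubtypeEquivOfLe hVW).finrank_eq] at hrn
  -- `S/(J + 𝔪^{d+1}) ≅ S/ker φ ≅ range φ`
  have h1 : finrank K (MvPolynomial (Fin n) K ⧸ (J ⊔ idealOfVars (Fin n) K ^ (d + 1))) =
      finrank K (W.map V.mkQ) := by
    rw [← hrange, ← (LinearMap.quotKerEquivRange φ).finrank_eq,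
      (Submodule.quotEquivOfEq _ _ hker).finrank_eq,
      (Submodule.Quotient.restrictScalarsEquiv K (J ⊔ idealOfVars (Fin n) K ^ (d + 1))).finrank_eq]
  rw [h1]
  exact hrn

/-! ## Jets of an ideal versus its elements of low degree -/

/-- The elements of `J` of degree `≤ d` are (their own) `d`-jets of elements of `J`. [folklore] -/
theorem inf_restrictTotalDegree_le_map_jet (J : Ideal (MvPolynomial (Fin n) K)) (d : ℕ) :
    J.restrictScalars K ⊓ restrictTotalDegree (Fin n) K d ≤
      Submodule.map (jet K n d) (J.restrictScalars K) := by
  rintro f ⟨hfJ, hfd⟩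
  exact ⟨f, hfJ, jet_eq_self_of_totalDegree_le ((mem_restrictTotalDegree _ _ _).mp hfd)⟩

/-- For a HOMOGENEOUS ideal the `d`-jets of its elements are exactly its elements of degree `≤ d`.
[folklore] -/
theorem map_jet_eq_of_isHomogeneousIdeal {I : Ideal (MvPolynomial (Fin n) K)} (hI : IsHomogeneousIdeal I)
    (d : ℕ) :
    Submodule.map (jet K n d) (I.restrictScalars K) = I.restrictScalars K ⊓ restrictTotalDegree (Fin n) K d := by
  refine le_antisymm ?_ (inf_restrictTotalDegree_le_map_jet I d)
  rintro _ ⟨f, hf, rfl⟩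
  exact ⟨jet_mem_of_isHomogeneousIdeal hI hf d, (mem_restrictTotalDegree _ _ _).mpr (totalDegree_jet_le d f)⟩

/-- The translation `τ_v` is injective and preserves degrees, so
`dim (I ∩ S_{≤d}) ≤ dim (τ_v I ∩ S_{≤d})`. [folklore] -/
theorem finrank_inf_le_finrank_map_shift_inf (I : Ideal (MvPolynomial (Fin n) K)) (v : Fin n → K) (d : ℕ) :
    finrank K ↥(I.restrictScalars K ⊓ restrictTotalDegree (Fin n) K d) ≤
      finrank K ↥((I.map (shift v)).restrictScalars K ⊓ restrictTotalDegree (Fin n) K d) := by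
  haveI : Module.Finite K ↥((I.map (shift v)).restrictScalars K ⊓ restrictTotalDegree (Fin n) K d) :=
    Module.Finite.of_injective (Submodule.inclusion inf_le_right) (Submodule.inclusion_injective _)
  have hmap : Submodule.map (shift v).toLinearMap (I.restrictScalars K ⊓ restrictTotalDegree (Fin n) K d) ≤
      (I.map (shift v)).restrictScalars K ⊓ restrictTotalDegree (Fin n) K d := by
    rintro _ ⟨f, ⟨hfI, hfd⟩, rfl⟩
    refine ⟨Ideal.mem_map_of_mem _ hfI, (mem_restrictTotalDegree _ _ _).mpr ?_⟩
    exact (totalDegree_shift_le v f).trans ((mem_restrictTotalDegree _ _ _).mp hfd)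
  have hinj : Function.Injective (shift v).toLinearMap := shift_injective v
  calc finrank K ↥(I.restrictScalars K ⊓ restrictTotalDegree (Fin n) K d)
      = finrank K ↥(Submodule.map (shift v).toLinearMap
          (I.restrictScalars K ⊓ restrictTotalDegree (Fin n) K d)) :=
        (Submodule.equivMapOfInjective _ hinj _).finrank_eq
    _ ≤ _ := Submodule.finrank_mono hmap

/-! ## The hypothesis at the point `v` itself: `𝔪_v = ker(eval v)` -/

/-- The ideal of the origin is `(X_1, …, X_n)`: `ker(eval 0) = 𝔪`. [folklore] -/
theorem ker_eval_zero : RingHom.ker (eval (0 : Fin n → K)) = idealOfVars (Fin n) K := by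
  ext f
  rw [RingHom.mem_ker, ← pow_one (idealOfVars (Fin n) K), mem_pow_idealOfVars_iff',
    MvPolynomial.eval_zero, constantCoeff_eq]
  constructor
  · intro h x hx
    have hx0 : x = 0 := (Finsupp.degree_eq_zero_iff x).mp (by omega)
    rw [hx0]
    exact h
  · intro h
    exact h 0 (by rw [map_zero]; exact zero_lt_one)

/-- `τ_v` pulls the ideal of the origin back to the ideal `𝔪_v = ker(eval v)` of the point `v`
(`f(X + v)` vanishes at `0` iff `f` vanishes at `v`). [folklore] -/
theorem comap_shift_ker_eval_zero (v : Fin n → K) :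
    (RingHom.ker (eval (0 : Fin n → K))).comap (shift v) = RingHom.ker (eval v) := by
  ext f
  rw [Ideal.mem_comap, RingHom.mem_ker, RingHom.mem_ker, eval_shift, zero_add]

/-- `τ_v` is surjective (`τ_v ∘ τ_{-v} = id`). [folklore] -/
theorem shift_surjective (v : Fin n → K) : Function.Surjective (shift v) := fun g =>
  ⟨shift (-v) g, by rw [shift_shift, add_neg_cancel, shift_zero]⟩

/-- **`τ_v 𝔪_v = 𝔪`**: the translation maps the ideal of `v` onto the ideal of the origin. [folklore] -/
theorem map_shift_ker_eval (v : Fin n → K) :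
    (RingHom.ker (eval v)).map (shift v) = idealOfVars (Fin n) K := by
  rw [← comap_shift_ker_eval_zero, Ideal.map_comap_of_surjective _ (shift_surjective v), ker_eval_zero]

/-- `τ_v (I + 𝔪_v^{d+1}) = τ_v I + 𝔪^{d+1}`. [folklore] -/
theorem map_shift_sup_ker_eval_pow (I : Ideal (MvPolynomial (Fin n) K)) (v : Fin n → K) (d : ℕ) :
    (I ⊔ RingHom.ker (eval v) ^ (d + 1)).map (shift v) =
      I.map (shift v) ⊔ idealOfVars (Fin n) K ^ (d + 1) := by
  rw [Ideal.map_sup, Ideal.map_pow, map_shift_ker_eval]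

/-- The translation `τ_v` as a `K`-algebra automorphism of `K[X]`. [folklore] -/
def shiftEquiv (v : Fin n → K) : MvPolynomial (Fin n) K ≃ₐ[K] MvPolynomial (Fin n) K :=
  AlgEquiv.ofAlgHom (shift v) (shift (-v))
    (by ext i : 1; rw [AlgHom.comp_apply, shift_shift, add_neg_cancel, shift_zero, AlgHom.id_apply])
    (by ext i : 1; rw [AlgHom.comp_apply, shift_shift, neg_add_cancel, shift_zero, AlgHom.id_apply])

/-- `shiftEquiv v` acts as `shift v`. [folklore] -/
theorem shiftEquiv_apply (v : Fin n → K) (f : MvPolynomial (Fin n) K) : shiftEquiv v f = shift v f := rfl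

/-- **`H⁽¹⁾_{C,v}(d) = dim_K S/(I + 𝔪_v^{d+1}) = dim_K S/(τ_v I + 𝔪^{d+1})`**: the Hilbert–Samuel numbers
at the point `v` are those of the translated cone at the origin (`τ_v : S/(I + 𝔪_v^{d+1}) ≅
S/(τ_v I + 𝔪^{d+1})`). [folklore] -/
theorem finrank_quotient_sup_ker_eval_pow_eq (I : Ideal (MvPolynomial (Fin n) K)) (v : Fin n → K) (d : ℕ) :
    finrank K (MvPolynomial (Fin n) K ⧸ (I ⊔ RingHom.ker (eval v) ^ (d + 1))) =
      finrank K (MvPolynomial (Fin n) K ⧸ (I.map (shift v) ⊔ idealOfVars (Fin n) K ^ (d + 1))) := by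
  have hIJ : I.map (shift v) ⊔ idealOfVars (Fin n) K ^ (d + 1) =
      (I ⊔ RingHom.ker (eval v) ^ (d + 1)).map
        (shiftEquiv v : MvPolynomial (Fin n) K →+* MvPolynomial (Fin n) K) := by
    rw [← map_shift_sup_ker_eval_pow]
    rfl
  exact (Ideal.quotientEquivAlg _ _ (shiftEquiv v) hIJ).toLinearEquiv.finrank_eq

/-! ## Two bookkeeping lemmas on `τ_v` and `coneIdeal` -/

/-- `τ_{-v}` maps `τ_v I` back into `I`. [folklore] -/
theorem shift_neg_mem_of_mem_map_shift {I : Ideal (MvPolynomial (Fin n) K)} (v : Fin n → K)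
    {g : MvPolynomial (Fin n) K} (hg : g ∈ I.map (shift v)) : shift (-v) g ∈ I := by
  have hle : I.map (shift v) ≤ Ideal.comap (shift (-v)) I := by
    rw [Ideal.map_le_iff_le_comap]
    intro f hf
    rw [Ideal.mem_comap, Ideal.mem_comap, shift_shift, neg_add_cancel, shift_zero]
    exact hf
  exact hle hg

/-- Over `k' = K` the ideal of the cone `C ×_K K` is `I` itself. [folklore] -/
theorem coneIdeal_self (I : Ideal (MvPolynomial (Fin n) K)) : coneIdeal K I = I := by
  have hmap : (MvPolynomial.map (algebraMap K K) : MvPolynomial (Fin n) K →+* MvPolynomial (Fin n) K) =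
      RingHom.id _ := by
    refine RingHom.ext fun p => ?_
    rw [Algebra.algebraMap_self, MvPolynomial.map_id, RingHom.id_apply]
  rw [coneIdeal, hmap, Ideal.map_id]

end CampaignW42

end Summit.ResolutionOfSingularities.ResolutionOfSingularities.Theorems
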